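import Summits.CriticalPhenomena.PercolationContinuityZ3.Theorems.Transplant.SkelPhiWinLevels
import Summits.CriticalPhenomena.PercolationContinuityZ3.Theorems.Transplant.SkelHabLevels
import HarnessLib

/-!
# D″ node, STRUCTURE-FREE generic layer (SHEAR-SCOPE §3.14 ruling (B″), V98; DPRIME-SCOPE L5′/L6′): Kozma–Nitzan Lemma 10 over the
# HABITAT-RESTRICTED WINDOW GRAPH `winGraphIn G Ω` of a bare planar map `φ : V → ℤ²` — the windows `WinIn φ Ω P = Ω ∩ φ⁻¹ P`, the planar
# levels `B⟨j⟩ = Ω ∩ φ⁻¹ Icc (lo − j) (hi + j)`, the level axioms, the boundary characterisations and Step II over `Ω` — φ-level re-cut of the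
# Φ-DEPENDENT declarations of `SkelHabLevels` §2–§3 (p2-g4)

builds on p205010 (kernel theorem, internal audit signed; external expert review pending) — nothing in this file uses p205010.
Lane `prim-bschramm`, seat `prim-hp-8` (gen 29; V98 hp-8 column, claim 2026-08-21T03:48Z); helper file (`--supports stmt-CriticalPhenomena-4575`).
Hypotheses through p3-g7's dictionary (`SkelPhiCylBall` §0): `hlip : Skelφ.Lip G φ` for the level nesting / amendment (A),
`hΔ : ∀ v, G.degree v ≤ Δ` for Step II; the windows and levels themselves need neither the graph nor any hypothesis (`Skelφ.WinIn φ Ω P`).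
Instance-polymorphic (`[DecidableEq V]` section binder from §2 on, lane convention p3-g4 2026-08-20 19:11:29Z (3)).  The Φ-FREE originals
are IMPORTED, not re-declared: `Skel.winGraphIn G Ω` with its §1 (`winGraphIn_adj`, `degree_winGraphIn_le`, …) and §4 (`Skel.lattW_winGraphIn_eq`,
`Skel.real_eq_of_determinedBy_winIn`) of `SkelHabLevels`.  This is the layer the corridor residue (C) and the inner routes of (F) consume with
`Ω := B_G(root, Rπ) ∩ U` (SHEAR-SCOPE §2.6, §3.10).
* §1 `Skelφ.WinIn φ Ω P`, `mem_WinIn`, `WinIn_mono`, `WinIn_subset`, `Skelφ.winLevelIn φ Ω lo hi j`, `mem_winLevelIn_iff`, `winLevelIn_zero`,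
  `winLevelIn_subset`, `winLevelIn_monotone`, `winLDataIn G φ Ω lo hi o Sfin` (+ `reachB_winLDataIn`);
* §2 (`[DecidableEq V]`) `mem_outerBoundary_winIn_iff` / `mem_innerBoundary_winIn_iff`, **`winLevelIn_nest (hlip)`**,
  `mem_sdiff_of_mem_outerBoundary_winLevelIn`, `not_mem_innerBoundary_winIn_of_mem_Icc` (amendment (A));
* §3 `lhyp_winIn (hlip)`, **`stepII_winIn (hlip) (hΔ)`**;
* §4 bridges (`rfl`): `PlanarSkeletonConc.WinIn_eq_skelφ`, `Skel.winLevelIn_eq_skelφ`, `Skel.winLDataIn_eq_skelφ`.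
[cite: KozmaNitzan2024, §4 Lemma 10, pp. 17–18 (Steps I–II), p. 15 (B⟨R⟩, ∂_ev B), p. 17 (subbox, ∂_iv D) — the ℤ^d model]
[cite: GrimmettPercolation1999, §7.2]
-/

noncomputable section

open MeasureTheory ProbabilityTheory
open scoped ENNReal

namespace Summit.CriticalPhenomena.PercolationContinuityZ3.Theorems.Transplant

namespace Skelφ

open Literature.Probability.Percolation Literature.Probability.LatticeModels SimpleGraph
open KNLevels Skel
open KozmaNitzan (wireSet_mono)
open scoped Classical

variable {V : Type} (G : SimpleGraph V) (φ : V → Site 2)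

/-! ## §1 Windows and planar levels over a vertex set `Ω`; level data -/

/-- **The window over the planar set `P` inside the vertex set `Ω`** for the planar map `φ`: `Ω ∩ φ⁻¹ P` (φ-level form of
`PlanarSkeletonConc.WinIn`; `Skelφ.Win G φ w₀ P R` is the case `Ω = B_G(w₀, R)`). [this work] -/
def WinIn (Ω : Finset V) (P : Finset (Site 2)) : Finset V := Ω.filter fun g => φ g ∈ P

/-- Membership in a window over `Ω`. [folklore] -/
theorem mem_WinIn {Ω : Finset V} {P : Finset (Site 2)} {g : V} : g ∈ WinIn φ Ω P ↔ g ∈ Ω ∧ φ g ∈ P := Finset.mem_filter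

/-- Windows grow with the vertex set and the planar set. [folklore] -/
theorem WinIn_mono {Ω Ω' : Finset V} (hΩ : Ω ⊆ Ω') {P P' : Finset (Site 2)} (hP : P ⊆ P') : WinIn φ Ω P ⊆ WinIn φ Ω' P' := by
  intro g hg
  rw [mem_WinIn] at hg ⊢
  exact ⟨hΩ hg.1, hP hg.2⟩

/-- Windows over `Ω` lie in `Ω`. [folklore] -/
theorem WinIn_subset (Ω : Finset V) (P : Finset (Site 2)) : WinIn φ Ω P ⊆ Ω := Finset.filter_subset _ _

/-- **The window levels over `Ω`** `B⟨j⟩ := Ω ∩ φ⁻¹ Icc (lo - j) (hi + j)` (φ-level form of `Skel.winLevelIn`).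
[this work] -/
def winLevelIn (Ω : Finset V) (lo hi : Site 2) (j : ℕ) : Finset V := WinIn φ Ω (Finset.Icc (lo - (j : Site 2)) (hi + (j : Site 2)))

/-- Membership in a window level over `Ω`. [folklore] -/
theorem mem_winLevelIn_iff {Ω : Finset V} {lo hi : Site 2} {j : ℕ} {v : V} :
    v ∈ winLevelIn φ Ω lo hi j ↔ v ∈ Ω ∧ φ v ∈ Finset.Icc (lo - (j : Site 2)) (hi + (j : Site 2)) := by
  rw [winLevelIn, mem_WinIn]

/-- Level `0` is the window over `Icc lo hi`. [folklore] -/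
theorem winLevelIn_zero (Ω : Finset V) (lo hi : Site 2) : winLevelIn φ Ω lo hi 0 = WinIn φ Ω (Finset.Icc lo hi) := by
  simp [winLevelIn]

/-- Window levels over `Ω` lie in `Ω`. [folklore] -/
theorem winLevelIn_subset (Ω : Finset V) (lo hi : Site 2) (j : ℕ) : winLevelIn φ Ω lo hi j ⊆ Ω := WinIn_subset φ Ω _

/-- **Level axiom 1**: the window levels over `Ω` increase. [folklore] -/
theorem winLevelIn_monotone (Ω : Finset V) (lo hi : Site 2) : Monotone (winLevelIn φ Ω lo hi) := by
  intro j j' h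
  refine WinIn_mono φ subset_rfl (Finset.Icc_subset_Icc (fun i => ?_) (fun i => ?_)) <;>
    simp only [Pi.sub_apply, Pi.add_apply, Pi.natCast_apply] <;> omega

/-- **The level data in the window graph over `Ω`** of the planar map `φ`: levels `winLevelIn φ Ω lo hi`, source `o`, support `Sfin`
(φ-level form of `Skel.winLDataIn`). [this work] -/
def winLDataIn (Ω : Finset V) (lo hi : Site 2) (o : V) (Sfin : Finset V) : LData (winGraphIn G Ω) :=
  ⟨winLevelIn φ Ω lo hi, o, Sfin⟩

/-- The levels of `winLDataIn`. [folklore] -/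
@[simp] theorem winLDataIn_X (Ω : Finset V) (lo hi : Site 2) (o : V) (Sfin : Finset V) :
    (winLDataIn G φ Ω lo hi o Sfin).X = winLevelIn φ Ω lo hi := rfl

/-- The source of `winLDataIn`. [folklore] -/
@[simp] theorem winLDataIn_o (Ω : Finset V) (lo hi : Site 2) (o : V) (Sfin : Finset V) : (winLDataIn G φ Ω lo hi o Sfin).o = o := rfl

/-- The support of `winLDataIn`. [folklore] -/
@[simp] theorem winLDataIn_Sfin (Ω : Finset V) (lo hi : Site 2) (o : V) (Sfin : Finset V) :
    (winLDataIn G φ Ω lo hi o Sfin).Sfin = Sfin := rfl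

/-- `{o ↔ B}` for the window data over `Ω` is `{o ↔ WinIn Ω (Icc lo hi)}`. [folklore] -/
theorem reachB_winLDataIn (Ω : Finset V) (lo hi : Site 2) (o : V) (Sfin : Finset V) :
    (winLDataIn G φ Ω lo hi o Sfin).reachB = ⋃ b ∈ WinIn φ Ω (Finset.Icc lo hi), openConn o b := by
  rw [LData.reachB, winLDataIn_X, winLevelIn_zero]; rfl

/-! ## §2 Boundaries of windows and levels in the window graph over `Ω`; nesting; the annulus; amendment (A) -/

variable [G.LocallyFinite] [DecidableEq V]

/-- **Outer boundary of a window in the window graph over `Ω`**: `x ∈ ∂^{out} WinIn Ω P` iff `x ∈ Ω`, `φ x ∉ P`, and `x` has a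
`G`-neighbour in `Ω` with planar coordinate in `P`. [cite: KozmaNitzan2024, §4 p. 15 (∂_ev B)] -/
theorem mem_outerBoundary_winIn_iff {Ω : Finset V} {P : Finset (Site 2)} {x : V} :
    x ∈ outerBoundary (winGraphIn G Ω) (WinIn φ Ω P) ↔ x ∈ Ω ∧ φ x ∉ P ∧ ∃ y, G.Adj x y ∧ y ∈ Ω ∧ φ y ∈ P := by
  rw [mem_outerBoundary_iff]
  constructor
  · rintro ⟨hx, y, hy, hxy⟩
    rw [mem_WinIn] at hy
    obtain ⟨hadj, hx1, hy1⟩ := (winGraphIn_adj G).1 hxy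
    exact ⟨hx1, fun h => hx ((mem_WinIn φ).2 ⟨hx1, h⟩), y, hadj, hy1, hy.2⟩
  · rintro ⟨hx1, hxP, y, hxy, hy1, hyP⟩
    exact ⟨fun h => hxP ((mem_WinIn φ).1 h).2, y, (mem_WinIn φ).2 ⟨hy1, hyP⟩, (winGraphIn_adj G).2 ⟨hxy, hx1, hy1⟩⟩

/-- **Inner boundary of a window in the window graph over `Ω`**: `v ∈ ∂^{in} WinIn Ω P` iff `v ∈ WinIn Ω P` and `v` has a `G`-neighbour
in `Ω` whose planar coordinate is outside `P`. [cite: KozmaNitzan2024, §4 p. 17 (∂_iv D)] -/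
theorem mem_innerBoundary_winIn_iff {Ω : Finset V} {P : Finset (Site 2)} {v : V} :
    v ∈ innerBoundary (winGraphIn G Ω) (WinIn φ Ω P) ↔ (v ∈ Ω ∧ φ v ∈ P) ∧ ∃ y, G.Adj v y ∧ y ∈ Ω ∧ φ y ∉ P := by
  rw [mem_innerBoundary_iff, mem_WinIn]
  constructor
  · rintro ⟨hv, y, hy, hvy⟩
    obtain ⟨hadj, -, hy1⟩ := (winGraphIn_adj G).1 hvy
    exact ⟨hv, y, hadj, hy1, fun h => hy ((mem_WinIn φ).2 ⟨hy1, h⟩)⟩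
  · rintro ⟨hv, y, hvy, hy1, hyP⟩
    exact ⟨hv, y, fun h => hyP ((mem_WinIn φ).1 h).2, (winGraphIn_adj G).2 ⟨hvy, hv.1, hy1⟩⟩

variable {G φ}

/-- **Level axiom 2** (from `Lip`): the outer boundary (in the window graph over `Ω`) of `B⟨j⟩` lies in `B⟨j+1⟩` — by the Lipschitz step.
[cite: KozmaNitzan2024, §4 p. 15 (∂_ev B ⊆ B⟨1⟩)] -/
theorem winLevelIn_nest (hlip : Lip G φ) (Ω : Finset V) (lo hi : Site 2) (j : ℕ) :
    outerBoundary (winGraphIn G Ω) (winLevelIn φ Ω lo hi j) ⊆ winLevelIn φ Ω lo hi (j + 1) := by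
  intro x hx
  obtain ⟨hx1, -, y, hxy, -, hyP⟩ := (mem_outerBoundary_winIn_iff G φ).1 hx
  rw [mem_winLevelIn_iff]
  refine ⟨hx1, ?_⟩
  have h := φ_mem_Icc_enlarge_of_adj hlip hyP hxy.symm
  refine Finset.Icc_subset_Icc (fun i => ?_) (fun i => ?_) h <;>
    simp only [Pi.sub_apply, Pi.add_apply, Pi.natCast_apply, Pi.one_apply] <;> push_cast <;> omega

/-- A contact vertex of level `j` (outer boundary in the window graph over `Ω`) lies in the planar ANNULUS `B⟨j+1⟩ ∖ B⟨j⟩`. [folklore] -/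
theorem mem_sdiff_of_mem_outerBoundary_winLevelIn (hlip : Lip G φ) {Ω : Finset V} {lo hi : Site 2} {j : ℕ} {x : V}
    (hx : x ∈ outerBoundary (winGraphIn G Ω) (winLevelIn φ Ω lo hi j)) :
    x ∈ winLevelIn φ Ω lo hi (j + 1) \ winLevelIn φ Ω lo hi j :=
  Finset.mem_sdiff.2 ⟨winLevelIn_nest hlip Ω lo hi j hx, (mem_outerBoundary_iff.1 hx).1⟩

/-- **Amendment (A)** (from `Lip`): a window vertex whose planar coordinate lies in the SHRUNK box `Icc (lo + 1) (hi - 1)` is not an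
inner-boundary vertex of `WinIn Ω (Icc lo hi)` in the window graph over `Ω`. [cite: KozmaNitzan2024, §4 p. 17 (∂_iv D)] -/
theorem not_mem_innerBoundary_winIn_of_mem_Icc (hlip : Lip G φ) {Ω : Finset V} {lo hi : Site 2} {v : V}
    (hv : φ v ∈ Finset.Icc (lo + 1) (hi - 1)) : v ∉ innerBoundary (winGraphIn G Ω) (WinIn φ Ω (Finset.Icc lo hi)) := by
  intro h
  obtain ⟨-, y, hvy, -, hyP⟩ := (mem_innerBoundary_winIn_iff G φ).1 h
  refine hyP ?_
  have h1 := φ_mem_Icc_enlarge_of_adj hlip hv hvy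
  refine Finset.Icc_subset_Icc (fun i => ?_) (fun i => ?_) h1 <;>
    simp only [Pi.sub_apply, Pi.add_apply, Pi.one_apply] <;> omega

/-! ## §3 The hypotheses of Lemma 10 and Step II over `Ω` -/

/-- **The hypotheses of Lemma 10 for window levels over `Ω`** (from `Lip`): a subbox `D ⊇ B⟨Rl+1⟩` (in `winGraphIn G Ω`) of a finitely
supported weighting at parameter `p` and a source `o ∈ Sfin \ D` give `KNLevels.LHyp`. [cite: KozmaNitzan2024, §4 Lemma 10 (p. 17)] -/
theorem lhyp_winIn (hlip : Lip G φ) (Ω : Finset V) (lo hi : Site 2) {o : V} {Sfin D : Finset V} {Wt : Sym2 V → unitInterval}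
    {p : unitInterval} {Rl : ℕ} (hsub : IsSubbox (winGraphIn G Ω) Wt p D) (hfin : FinSupp Wt Sfin) (hDS : D ⊆ Sfin)
    (hencl : winLevelIn φ Ω lo hi (Rl + 1) ⊆ D) (ho : o ∉ D) (hoS : o ∈ Sfin) :
    LHyp (winLDataIn G φ Ω lo hi o Sfin) Wt p D Rl where
  mono := winLevelIn_monotone φ Ω lo hi
  nest := winLevelIn_nest hlip Ω lo hi
  sub := hsub
  fin := hfin
  DS := hDS
  encl := hencl
  o_not := ho
  o_mem := hoS

/-- **Kozma–Nitzan's Step II over the window levels over `Ω`** (from `Lip` and the degree bound `Δ`): φ-level form of `Skel.stepII_winIn`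
(the twin of `stepII_win` with `B_G(w₀, R) ↦ Ω`). [cite: KozmaNitzan2024, §4 p. 18 (Step II)] -/
theorem stepII_winIn [Countable V] (hlip : Lip G φ) {Δ : ℕ} (hΔ : ∀ v, G.degree v ≤ Δ) (Ω : Finset V) (lo hi : Site 2) {o : V}
    {Sfin D : Finset V} {Wt : Sym2 V → unitInterval} {p : unitInterval} {Rl : ℕ}
    (hsub : IsSubbox (winGraphIn G Ω) Wt p D) (hfin : FinSupp Wt Sfin) (hDS : D ⊆ Sfin)
    (hencl : winLevelIn φ Ω lo hi (Rl + 1) ⊆ D) (ho : o ∉ D) (hoS : o ∈ Sfin)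
    (hp1 : (p : ℝ) < 1) {N j₀ j₁ : ℕ} (hj₁ : j₁ ≤ Rl) {δ : ℝ}
    (hJ : 1 / (1 - (p : ℝ)) ^ (Δ * N) ≤ δ * ((Finset.Icc j₀ j₁).card : ℝ))
    (hreach : 1 - δ < (prodBernoulli Wt).real (⋃ b ∈ WinIn φ Ω (Finset.Icc lo hi), openConn o b)) :
    ∃ j ∈ Finset.Icc j₀ j₁, 1 - 2 * δ < (prodBernoulli Wt).real {ω | N ≤ ((winLDataIn G φ Ω lo hi o Sfin).Kont j ω).card} := by
  have hL := lhyp_winIn hlip Ω lo hi hsub hfin hDS hencl ho hoS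
  rw [← reachB_winLDataIn G φ Ω lo hi o Sfin] at hreach
  exact hL.stepII (degree_winGraphIn_le G hΔ Ω) hp1 hj₁ hJ hreach

end Skelφ

/-! ## §4 Bridges: the structure-level windows and levels over `Ω` are the φ-level ones (by `rfl`) -/

namespace PlanarSkeletonConc

open Literature.Probability.LatticeModels

variable {V : Type} {G : SimpleGraph V} [G.LocallyFinite] (Φ : PlanarSkeletonConc G)

/-- `PlanarSkeletonConc.WinIn` is the φ-level window over `Ω` of `Φ.φ`. [folklore] -/
theorem WinIn_eq_skelφ (Ω : Finset V) (P : Finset (Site 2)) : Φ.WinIn Ω P = Skelφ.WinIn Φ.φ Ω P := rfl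

end PlanarSkeletonConc

namespace Skel

open Literature.Probability.LatticeModels

variable {V : Type} {G : SimpleGraph V} [G.LocallyFinite] (Φ : PlanarSkeletonConc G)

/-- `Skel.winLevelIn` is the φ-level window level over `Ω` of `Φ.φ`. [folklore] -/
theorem winLevelIn_eq_skelφ (Ω : Finset V) (lo hi : Site 2) (j : ℕ) :
    winLevelIn Φ Ω lo hi j = Skelφ.winLevelIn Φ.φ Ω lo hi j := rfl

/-- `Skel.winLDataIn` is the φ-level level data over `Ω` of `Φ.φ`. [folklore] -/
theorem winLDataIn_eq_skelφ (Ω : Finset V) (lo hi : Site 2) (o : V) (Sfin : Finset V) :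
    winLDataIn Φ Ω lo hi o Sfin = Skelφ.winLDataIn G Φ.φ Ω lo hi o Sfin := rfl

end Skel

end Summit.CriticalPhenomena.PercolationContinuityZ3.Theorems.Transplant

end
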